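import Summits.HodgeConjecture.HodgeConjecture.Theorems.PadicSemiregularLiftHodgeAbelianVarietiesStubCmAnchoredFamilies
import Literature.AlgebraicGeometry.HodgeTheory.InvariantClassesFromTotalSpaceHolds

/-!
# Crux `HodgeAbelianVarieties` (stmt-HodgeConjecture-1333), line `cm-pivot` — stub `stub_cmAnchoredFamilies` (`CMAnchoredFamilies[]`, CHILD 2): the honest reduction, sharpened

The registered stub `stub_cmAnchoredFamilies : CMAnchoredFamilies[]` (skeleton
`Cruxes/HodgeAbelianVarieties/Lines/cm_pivot.lean`) is the CM-ANCHORED MUMFORD–TATE PACKAGING: every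
rational `(p,p)`-class `c` on a complex abelian variety `A` is `e^* G` for a global class
`G ∈ H²ᵖ(𝒳(ℂ); ℂ)` of a smooth projective family `f : 𝒳 ⟶ S` (`𝒳`, `S` quasi-projective, `S` smooth
irreducible) with `A` THE fibre at `t`, a CM fibre `A₀` at `s₀`, and `G` rational `(p,p)` on every
abelian fibre. TRUE in print (universal family over `A_{g,d,N}`; the Hodge-locus component through
`(A, c)` is algebraic, Cattani–Deligne–Kaplan 1995 Cor. 1.2, and special, Deligne 1982, hence has CM
points, Mumford 1969; theorem of the fixed part), NOT provable today: the tree has no moduli scheme of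
polarised abelian varieties, no universal abelian scheme, Cattani–Deligne–Kaplan only as the
parametrised `Prop` `CattaniDeligneKaplan1995_hodgeLocus_algebraicFor`, no Mumford–Tate domains / CM
density (tree search 2026-08-17).

WHAT CHANGED since the gallery line's treatment of the same clause (file
`PadicSemiregularLiftHodgeAbelianVarietiesStubCmAnchoredFamilies`, whose registered reduction is
`HodgeLocusCMSection[] → Hironaka[] → deligne_globalInvariantCycles → CMFamilies[]`): two of its three
antecedents are now THEOREMS of the tree —

* `HodgeTheory.deligne1968_invariantClass_fromTotalSpace_holds` (Deligne 1968 / Voisin II Thm. 4.18,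
  DISCHARGED): over a smooth quasi-projective base, a continuous section of the espace étalé of
  `Rᵏ f_* ℂ` of a smooth projective family WITH QUASI-PROJECTIVE TOTAL SPACE is, at any point, the
  restriction of a class of the total space `𝒳` itself — no compactification needed, so neither
  `Hironaka[]` nor the partie fixe `deligne_globalInvariantCycles` (still unproved) is used here;
* `HodgeTheory.Hironaka1964_smoothCompactification_holds` (its statement is `Hironaka[]` verbatim) —
  recorded for the gallery reduction; not needed below.

PROVED here (axioms `propext` / `Classical.choice` / `Quot.sound`):

* `cmAnchored_of_section` — **the packaging of ONE triple `(A, p, c)` from section data**: a smooth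
  projective family over a smooth irreducible quasi-projective base with quasi-projective total
  space, `A ≅ 𝒳_t`, a CM fibre at `s₀`, and a continuous section `σ` of `FiberClass f (2p)` through
  `c` valued in the locus of Hodge classes give `CMAnchored[A, p, c]` (with its `QProj[𝒳]` conjunct):
  Deligne 1968 lifts `σ(t)` to `G ∈ H²ᵖ(𝒳(ℂ); ℂ)`, the identity principle
  (`Stubs.fiberClass_section_eq_of_eq`) makes `σ` THE global section of `G`.
* `stub_cmAnchoredFamilies_of_hodgeLocusCMSection` (REGISTERED helper) — **`HodgeLocusCMSection[] →
  CMAnchoredFamilies[]`**, the gallery file's moduli-theoretic input ALONE now implies child 2: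
  `QProj[𝒳]` comes from its embedding clause `𝒳 ↪ ℙᴺ × S` (closed) over the quasi-projective `S`
  (`IsQuasiProjectiveOver.of_isClosedImmersion_projectiveSpace_tensor`, Segre).
* `cmAnchored_of_isCM`, `cmAnchoredFamilies_of_forall_not_isCM` — the CM sector (and `dim A = 0`) is
  the constant family `A ⟶ Spec ℂ` (total space `A`, projective, hence quasi-projective);
  `cmAnchoredFamilies_of_nonCMSections` — **the sharpest form**: section data with `QProj[𝒳]` (no
  embedding asked) for the NON-CM abelian varieties only suffice.

HONEST REMAINDER (= what `HodgeLocusCMSection[]` / `NonCMSections[]` encode and the tree lacks): the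
fine moduli scheme `A_{g,d,N}` with its universal family (GIT Thm. 7.9), the component of the locus of
Hodge classes through `(A, c)` as a closed algebraic subvariety finite over the base (CDK Thm. 1.1 /
Cor. 1.2 as a closed statement on `GeometricVHSData` of the universal family), its resolution
(available: `Resolution.Hironaka1964_holds`), and ONE CM point on it (Deligne 1982 + Mumford 1969 §3 /
GGK VI.C.1). playbook: none fit (packaging/transport pattern of the gallery stub file reused).
-/

set_option linter.dupNamespace false

noncomputable section

open CategoryTheory MonoidalCategory AlgebraicGeometry
open Literature.AlgebraicGeometry Literature.AlgebraicGeometry.Motives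

namespace Summit.HodgeConjecture.HodgeConjecture.Cruxes.HodgeAbelianVarieties.CMPivot.Stubs

/-! ### The statements (copied byte-identically from the registered skeleton `Lines/cm_pivot.lean`) -/

/-- `IsCM[A]` — CM type: an endomorphism with `2 · dim A` distinct eigenvalues on `H¹(A(ℂ); ℂ)`
(verbatim the gallery line's notation). Local notation only. -/
local notation3 (prettyPrint := false) "IsCM[" A "]" =>
  ∃ (ψ : A ⟶ A) (μ : Fin (2 * AbelianVariety.dim A) → ℂ), Function.Injective μ ∧
    ∀ i, Module.End.HasEigenvalue (HodgeTheory.complexBetti.map ψ.hom.hom.hom 1).hom (μ i)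

/-- `QProj[X]` — `X` is quasi-projective over `ℂ`: INLINED body of
`HodgeTheory.IsQuasiProjectiveOver X` (the route file does not import its home module). Local notation only. -/
local notation3 (prettyPrint := false) "QProj[" X "]" =>
  ∃ (P : SchemeOver ℂ) (j : X ⟶ P), IsProjectiveOver P ∧ AlgebraicGeometry.IsOpenImmersion j.left

/-- `FibreIncl[f, B, e, s]` — `e` presents `B` as THE fibre of `f` over `s` (`≫` spelled out). Local notation only. -/
local notation3 (prettyPrint := false) "FibreIncl[" f ", " B ", " e ", " s "]" =>
  ∃ i : AbelianVariety.X B ≅ fiberOver f s, e = CategoryStruct.comp i.hom (fiberι f s)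

/-- `HodgeAlong[S, 𝒳, f, G, p]` — `G` is rational `(p,p)` on every fibre presented as an abelian variety. Local notation only. -/
local notation3 (prettyPrint := false) "HodgeAlong[" S ", " 𝒳 ", " f ", " G ", " p "]" =>
  ∀ (B : AbelianVariety ℂ) (eB : AbelianVariety.X B ⟶ 𝒳) (u : ComplexPoints S),
    FibreIncl[f, B, eB, u] →
      HodgeTheory.IsRationalClass (HodgeTheory.complexBetti.map eB (2 * p) G) ∧
      HodgeTheory.IsOfHodgeType B.dim B.X (2 * p) p p (HodgeTheory.complexBetti.map eB (2 * p) G)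

/-- CHILD 2 `CMAnchoredFamilies[]` — CM-anchored Mumford–Tate packaging of every rational `(p,p)` class
(the gallery line's `CMFamilies[]` clause (b), gen 3, with the total space quasi-projective; clause (a)
"Hodge models exist" dropped, being the theorem `Stubs.cmFamilies_nonempty_hodgeModel`). Local notation only. -/
local notation3 (prettyPrint := false) "CMAnchoredFamilies[]" =>
  ∀ (A : AbelianVariety ℂ) (p : ℕ) (c : HodgeTheory.complexBetti A.X (2 * p)),
    HodgeTheory.IsRationalClass c → HodgeTheory.IsOfHodgeType A.dim A.X (2 * p) p p c →
    ∃ (S 𝒳 : SchemeOver ℂ) (f : 𝒳 ⟶ S) (G : HodgeTheory.complexBetti 𝒳 (2 * p))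
      (t s₀ : ComplexPoints S) (e : A.X ⟶ 𝒳) (A₀ : AbelianVariety ℂ) (e₀ : A₀.X ⟶ 𝒳),
      QProj[𝒳] ∧ QProj[S] ∧ AlgebraicGeometry.Smooth S.hom ∧ IrreducibleSpace S.left ∧
      IsSmoothProjectiveFamily f A.dim ∧
      FibreIncl[f, A, e, t] ∧ FibreIncl[f, A₀, e₀, s₀] ∧ IsCM[A₀] ∧
      HodgeTheory.complexBetti.map e (2 * p) G = c ∧ HodgeAlong[S, 𝒳, f, G, p]

/-- `CMAnchored[A, p, c]` — the body of `CMAnchoredFamilies[]` for ONE triple `(A, p, c)` (same text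
with `A`, `p`, `c` free). Local notation only. -/
local notation3 (prettyPrint := false) "CMAnchored[" A ", " p ", " c "]" =>
  ∃ (S 𝒳 : SchemeOver ℂ) (f : 𝒳 ⟶ S) (G : HodgeTheory.complexBetti 𝒳 (2 * p))
    (t s₀ : ComplexPoints S) (e : AbelianVariety.X A ⟶ 𝒳) (A₀ : AbelianVariety ℂ) (e₀ : A₀.X ⟶ 𝒳),
    QProj[𝒳] ∧ QProj[S] ∧ AlgebraicGeometry.Smooth S.hom ∧ IrreducibleSpace S.left ∧
    IsSmoothProjectiveFamily f (AbelianVariety.dim A) ∧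
    FibreIncl[f, A, e, t] ∧ FibreIncl[f, A₀, e₀, s₀] ∧ IsCM[A₀] ∧
    HodgeTheory.complexBetti.map e (2 * p) G = c ∧ HodgeAlong[S, 𝒳, f, G, p]

/-- `HodgeLocusCMSection[]` — **the moduli-theoretic input** (copied byte-identically from the
gallery stub file `PadicSemiregularLiftHodgeAbelianVarietiesStubCmAnchoredFamilies`; HYPOTHESIS of the
registered reduction, not asserted). For every `A` and every rational `(p,p)`-class `c` on `A`: a
smooth projective family `f : 𝒳 ⟶ S` of relative dimension `dim A`, projective over `S` in
Hartshorne's sense (closed `S`-immersion into `ℙᴺ × S`), over a smooth irreducible quasi-projective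
complex base; `t` with `𝒳_t ≅ A`; `s₀` whose fibre is presented by a CM abelian variety `A₀`; and a
CONTINUOUS section `σ` of the espace étalé `FiberClass f (2p) → S(ℂ)` through `c` at `t`, valued in
rational `(p,p)`-classes. In print: the universal family over `A_{g,d,n}`, `n ≥ 3`; the component
through `(A, c)` of the locus of Hodge classes (Cattani–Deligne–Kaplan Thm. 1.1 / Cor. 1.2), resolved
and pulled back, `σ` = the tautological flat section; its image is a Mumford–Tate domain orbit
(Green–Griffiths–Kerr II.C.1), which contains CM points (GGK VI.C.1). Local notation only.
[cite: MumfordFogartyKirwan1994, Thm. 7.9] [cite: CattaniDeligneKaplan1995JAMS, Thm. 1.1 and Cor. 1.2]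
[cite: GreenGriffithsKerr2012, Thm. (II.C.1) and Lemma (VI.C.1)] -/
local notation3 (prettyPrint := false) "HodgeLocusCMSection[]" =>
  ∀ (A : AbelianVariety ℂ) (p : ℕ) (c : HodgeTheory.complexBetti A.X (2 * p)),
    HodgeTheory.IsRationalClass c → HodgeTheory.IsOfHodgeType A.dim A.X (2 * p) p p c →
    ∃ (S 𝒳 : SchemeOver ℂ) (f : 𝒳 ⟶ S) (t s₀ : ComplexPoints S) (i : A.X ≅ fiberOver f t)
      (A₀ : AbelianVariety ℂ) (e₀ : A₀.X ⟶ 𝒳) (σ : ComplexPoints S → HodgeTheory.FiberClass f (2 * p)),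
      HodgeTheory.IsQuasiProjectiveOver S ∧ AlgebraicGeometry.Smooth S.hom ∧ IrreducibleSpace S.left ∧
      IsSmoothProjectiveFamily f A.dim ∧
      (∃ (N : ℕ) (ι : 𝒳 ⟶ projectiveSpace N ℂ ⊗ S), IsClosedImmersion ι.left ∧
        ι ≫ CartesianMonoidalCategory.snd (projectiveSpace N ℂ) S = f) ∧
      FibreIncl[f, A₀, e₀, s₀] ∧ IsCM[A₀] ∧
      Continuous σ ∧ (∀ s, (σ s).pt = s) ∧
      (∀ s, σ s ∈ HodgeTheory.locusOfHodgeClasses f A.dim p) ∧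
      σ t = ⟨t, HodgeTheory.complexBetti.map i.inv (2 * p) c⟩

/-- `NonCMSections[]` — **the sharpest honest input**: the same section data, asked only for the
abelian varieties NOT of CM type, and with the embedding clause weakened to quasi-projectivity of
the total space `QProj[𝒳]` (all that Deligne 1968 consumes). Local notation only.
[cite: CattaniDeligneKaplan1995JAMS, Thm. 1.1 and Cor. 1.2] [cite: GreenGriffithsKerr2012, Lemma (VI.C.1)] -/
local notation3 (prettyPrint := false) "NonCMSections[]" =>
  ∀ (A : AbelianVariety ℂ), ¬ IsCM[A] → ∀ (p : ℕ) (c : HodgeTheory.complexBetti A.X (2 * p)),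
    HodgeTheory.IsRationalClass c → HodgeTheory.IsOfHodgeType A.dim A.X (2 * p) p p c →
    ∃ (S 𝒳 : SchemeOver ℂ) (f : 𝒳 ⟶ S) (t s₀ : ComplexPoints S) (i : A.X ≅ fiberOver f t)
      (A₀ : AbelianVariety ℂ) (e₀ : A₀.X ⟶ 𝒳) (σ : ComplexPoints S → HodgeTheory.FiberClass f (2 * p)),
      QProj[𝒳] ∧ QProj[S] ∧ AlgebraicGeometry.Smooth S.hom ∧ IrreducibleSpace S.left ∧
      IsSmoothProjectiveFamily f A.dim ∧
      FibreIncl[f, A₀, e₀, s₀] ∧ IsCM[A₀] ∧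
      Continuous σ ∧ (∀ s, (σ s).pt = s) ∧
      (∀ s, σ s ∈ HodgeTheory.locusOfHodgeClasses f A.dim p) ∧
      σ t = ⟨t, HodgeTheory.complexBetti.map i.inv (2 * p) c⟩

/-! ### The packaging of one triple from section data (Deligne 1968, a theorem of the tree) -/

/-- **`CMAnchored[A, p, c]` from section data.** Let `f : 𝒳 ⟶ S` be a smooth projective family of
relative dimension `dim A` with `𝒳` and `S` quasi-projective, `S` smooth irreducible, `i : A ≅ 𝒳_t`,
`e₀` presenting a CM abelian variety `A₀` as the fibre at `s₀`, and `σ` a continuous section of the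
espace étalé of `R²ᵖ f_* ℂ` with values in the locus of Hodge classes and `σ(t) = (t, (i⁻¹)^* c)`.
By Deligne 1968 (degeneration of Leray; Voisin II Thm. 4.18 — the tree's THEOREM
`deligne1968_invariantClass_fromTotalSpace_holds`) there is `G ∈ H²ᵖ(𝒳(ℂ); ℂ)` with
`σ(t) = (t, G|_{𝒳_t})`; the global section of `G` is continuous and agrees with `σ` at `t`, hence
everywhere (identity principle `Stubs.fiberClass_section_eq_of_eq`: Ehresmann + flatness); so
`(i ≫ ι_t)^* G = c`, and on every fibre `G` restricts to a value of `σ`, a rational `(p,p)`-class,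
transported to every abelian-variety presentation (`IsOfHodgeType.map_of_iso`, `schemeDim_eq_holds`).
[cite: VoisinHodgeII2003, Theorem 4.18 (with Lemma 4.17)] [cite: Deligne1968, Proposition (2.1) with (2.6.3)]
[cite: CharlesSchnell2014Notes, Proposition 11.3.5 (1)] -/
theorem cmAnchored_of_section (A : AbelianVariety ℂ) (p : ℕ) (c : HodgeTheory.complexBetti A.X (2 * p))
    {S 𝒳 : SchemeOver ℂ} (f : 𝒳 ⟶ S) (t s₀ : ComplexPoints S) (i : A.X ≅ fiberOver f t)
    (A₀ : AbelianVariety ℂ) (e₀ : A₀.X ⟶ 𝒳) (σ : ComplexPoints S → HodgeTheory.FiberClass f (2 * p))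
    (h𝒳 : HodgeTheory.IsQuasiProjectiveOver 𝒳) (hSqp : HodgeTheory.IsQuasiProjectiveOver S)
    (hS : AlgebraicGeometry.Smooth S.hom) (hSirr : IrreducibleSpace S.left)
    (hf : IsSmoothProjectiveFamily f A.dim) (hA₀ : FibreIncl[f, A₀, e₀, s₀]) (hCM : IsCM[A₀])
    (hσ : Continuous σ) (hpt : ∀ s, (σ s).pt = s)
    (hloc : ∀ s, σ s ∈ HodgeTheory.locusOfHodgeClasses f A.dim p)
    (hσt : σ t = ⟨t, HodgeTheory.complexBetti.map i.inv (2 * p) c⟩) :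
    CMAnchored[A, p, c] := by
  -- Deligne 1968: the value of `σ` at `t` comes from the (quasi-projective) total space `𝒳`
  obtain ⟨G, hG⟩ := HodgeTheory.deligne1968_invariantClass_fromTotalSpace_holds 𝒳 S f A.dim hf h𝒳
    hSqp hS (2 * p) σ hσ hpt t
  -- `σ` IS the global section of `G`
  have hsec : ∀ s, σ s = HodgeTheory.globalSection f (2 * p) G s :=
    SubtorusGalleryBlochSeeds.Stubs.fiberClass_section_eq_of_eq f hf hS hSqp hSirr (2 * p) hσ
      (HodgeTheory.continuous_globalSection f _ G) hpt (fun _ ↦ rfl) hG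
  have hGt : HodgeTheory.complexBetti.map (fiberι f t) (2 * p) G =
      HodgeTheory.complexBetti.map i.inv (2 * p) c :=
    (HodgeTheory.FiberClass.mk_eq_mk_iff _ _).1 ((hsec t).symm.trans hσt)
  refine ⟨S, 𝒳, f, G, t, s₀, i.hom ≫ fiberι f t, A₀, e₀, h𝒳, hSqp, hS, hSirr, hf, ⟨i, rfl⟩, hA₀, hCM,
    ?_, ?_⟩
  · rw [HodgeTheory.complexBetti.map_comp, CategoryTheory.comp_apply, hGt]
    exact i.complexBetti_map_hom_map_inv (2 * p) c
  · rintro B eB u ⟨i', rfl⟩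
    obtain ⟨hrat, hhodge⟩ := (HodgeTheory.mem_locusOfHodgeClasses_iff _).1 ((hsec u) ▸ hloc u)
    dsimp only [HodgeTheory.cls_globalSection, HodgeTheory.pt_globalSection] at hrat hhodge
    rw [HodgeTheory.complexBetti.map_comp, CategoryTheory.comp_apply]
    refine ⟨hrat.pullback _, ?_⟩
    rw [show B.dim = A.dim from schemeDim_eq_holds ((hf.isSmoothProjective u).of_iso i'.symm)]
    exact hhodge.map_of_iso i'

/-! ### Quasi-projectivity of the total space of an embedded family -/

/-- **The total space of an embedded family over a quasi-projective base is quasi-projective**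
(`𝒳 ↪ ℙᴺ × S` closed, `ℙᴺ × S` quasi-projective by Segre): the `QProj[𝒳]` conjunct of child 2 from
the embedding clause of `HodgeLocusCMSection[]`. [cite: Hartshorne1977, Ch. II §4 (p. 103) and Ex. 4.9] -/
theorem qProj_of_embedding {S 𝒳 : SchemeOver ℂ} {f : 𝒳 ⟶ S}
    (hι : ∃ (N : ℕ) (ι : 𝒳 ⟶ projectiveSpace N ℂ ⊗ S), IsClosedImmersion ι.left ∧
      ι ≫ CartesianMonoidalCategory.snd (projectiveSpace N ℂ) S = f)
    (hSqp : HodgeTheory.IsQuasiProjectiveOver S) : QProj[𝒳] := by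
  obtain ⟨N, ι, hι, -⟩ := hι
  haveI := hι
  exact HodgeTheory.IsQuasiProjectiveOver.of_isClosedImmersion_projectiveSpace_tensor ι hSqp

/-! ### The CM sector is the constant family; only the non-CM abelian varieties need the input -/

/-- **The CM sector of child 2 is the constant family** `A ⟶ Spec ℂ` (global class `G = c`, both
marked fibres `A` itself presented by `𝟙 A`; the total space `A` is projective, hence
quasi-projective; base, family, fibre and `HodgeAlong` clauses are the gallery file's
`unit_base`, `isSmoothProjectiveFamily_toUnit`, `fibreIncl_toUnit`, `hodgeAlong_toUnit`). [folklore] -/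
theorem cmAnchored_of_isCM (A : AbelianVariety ℂ) (hA : IsCM[A]) (p : ℕ)
    (c : HodgeTheory.complexBetti A.X (2 * p)) (hc : HodgeTheory.IsRationalClass c)
    (hh : HodgeTheory.IsOfHodgeType A.dim A.X (2 * p) p p c) : CMAnchored[A, p, c] := by
  refine ⟨𝟙_ (SchemeOver ℂ), A.X, CartesianMonoidalCategory.toUnit A.X, c,
    CartesianMonoidalCategory.toUnit _, CartesianMonoidalCategory.toUnit _, 𝟙 A.X, A, 𝟙 A.X,
    HodgeTheory.IsQuasiProjectiveOver.of_isProjectiveOver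
      (AbelianVariety.isSmoothProjective_holds (A := A)).isProjectiveOver,
    SubtorusGalleryBlochSeeds.Stubs.unit_base.1, SubtorusGalleryBlochSeeds.Stubs.unit_base.2.1,
    SubtorusGalleryBlochSeeds.Stubs.unit_base.2.2,
    SubtorusGalleryBlochSeeds.Stubs.isSmoothProjectiveFamily_toUnit A,
    SubtorusGalleryBlochSeeds.Stubs.fibreIncl_toUnit A _,
    SubtorusGalleryBlochSeeds.Stubs.fibreIncl_toUnit A _, hA, ?_,
    SubtorusGalleryBlochSeeds.Stubs.hodgeAlong_toUnit hc hh⟩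
  rw [HodgeTheory.complexBetti.map_id]
  rfl

/-- **Child 2 reduces to packaging the NON-CM abelian varieties** (the CM sector, including the
degenerate end `dim A = 0` where `IsCM[A]` is vacuous, is the constant family). [folklore] -/
theorem cmAnchoredFamilies_of_forall_not_isCM
    (h : ∀ (A : AbelianVariety ℂ), ¬ IsCM[A] → ∀ (p : ℕ) (c : HodgeTheory.complexBetti A.X (2 * p)),
      HodgeTheory.IsRationalClass c → HodgeTheory.IsOfHodgeType A.dim A.X (2 * p) p p c →
        CMAnchored[A, p, c]) :
    CMAnchoredFamilies[] := by
  intro A p c hc hh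
  by_cases hA : IsCM[A]
  · exact cmAnchored_of_isCM A hA p c hc hh
  · exact h A hA p c hc hh

/-- **The sharpest honest reduction of child 2**: section data with quasi-projective total space for
the non-CM abelian varieties only (`NonCMSections[]`) imply `CMAnchoredFamilies[]`
(`cmAnchored_of_section` off the CM sector, the constant family on it).
[cite: VoisinHodgeII2003, Theorem 4.18] [cite: CattaniDeligneKaplan1995JAMS, Thm. 1.1 and Cor. 1.2] -/
theorem cmAnchoredFamilies_of_nonCMSections : NonCMSections[] → CMAnchoredFamilies[] :=
  fun h ↦ cmAnchoredFamilies_of_forall_not_isCM fun A hA p c hc hh ↦ by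
    obtain ⟨S, 𝒳, f, t, s₀, i, A₀, e₀, σ, h𝒳, hSqp, hS, hSirr, hf, hA₀, hCM, hσ, hpt, hloc, hσt⟩ :=
      h A hA p c hc hh
    exact cmAnchored_of_section A p c f t s₀ i A₀ e₀ σ h𝒳 hSqp hS hSirr hf hA₀ hCM hσ hpt hloc hσt

/-- `HodgeLocusCMSection[]` supplies `NonCMSections[]` (forget the CM case, weaken the embedding to
quasi-projectivity of the total space) — so the registered reduction factors through the sharpest
one. [folklore] -/
theorem nonCMSections_of_hodgeLocusCMSection : HodgeLocusCMSection[] → NonCMSections[] := by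
  intro hM A _ p c hc hh
  obtain ⟨S, 𝒳, f, t, s₀, i, A₀, e₀, σ, hSqp, hS, hSirr, hf, hι, hA₀, hCM, hσ, hpt, hloc, hσt⟩ :=
    hM A p c hc hh
  exact ⟨S, 𝒳, f, t, s₀, i, A₀, e₀, σ, qProj_of_embedding hι hSqp, hSqp, hS, hSirr, hf, hA₀, hCM, hσ,
    hpt, hloc, hσt⟩

/-! ### The registered reduction: child 2 from the moduli-theoretic input alone -/

/-- **REGISTERED HELPER — child 2 `CMAnchoredFamilies[]` from the moduli-theoretic input
`HodgeLocusCMSection[]` ALONE.** Compared with the gallery file's registered reduction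
`HodgeLocusCMSection[] → Hironaka[] → deligne_globalInvariantCycles → CMFamilies[]`, Hironaka's
compactification and Deligne's partie fixe are no longer antecedents (Deligne 1968 on the
quasi-projective total space, a theorem of the tree, replaces both), and the conclusion carries the
extra conjunct `QProj[𝒳]` of the `cm-pivot` child (`qProj_of_embedding`). The proof factors through
the sharpest form: `HodgeLocusCMSection[] → NonCMSections[] → CMAnchoredFamilies[]` (the CM sector is
served by the constant family, the rest by `cmAnchored_of_section`). What remains hypothetical is
exactly the moduli construction: `A_{g,d,N}` with its universal family, the Hodge-locus component
through `(A, c)` as a closed algebraic subvariety (Cattani–Deligne–Kaplan), and a CM point on it.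
[cite: CattaniDeligneKaplan1995JAMS, Thm. 1.1 and Cor. 1.2] [cite: VoisinHodgeII2003, Theorem 4.18]
[cite: MumfordFogartyKirwan1994, Thm. 7.9] -/
theorem stub_cmAnchoredFamilies_of_hodgeLocusCMSection : HodgeLocusCMSection[] → CMAnchoredFamilies[] :=
  fun hM ↦ cmAnchoredFamilies_of_nonCMSections (nonCMSections_of_hodgeLocusCMSection hM)

end Summit.HodgeConjecture.HodgeConjecture.Cruxes.HodgeAbelianVarieties.CMPivot.Stubs

end
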